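import Summits.BirchSwinnertonDyer.BirchSwinnertonDyer.Theorems.ManinLocalTwoThreeBasisSolveFiftyTwo
import Summits.BirchSwinnertonDyer.BirchSwinnertonDyer.Theorems.ManinLocalTwoThreeCurveSideFiftyTwo
import Summits.BirchSwinnertonDyer.BirchSwinnertonDyer.Theorems.ManinLocalTwoThreeFrickeRowsFiftyTwo
import HarnessLib

/-!
# Level 52 (C2 domain, genus 5), part 2f: THE NEWFORM OF EVERY `X₀(52)`-DATUM IS `F₅₂ₐ`, FACT-FREE — by the FRICKE SIEVE

Cell `bsd-f2-manin`, route `ManinLocalTwoThree`, crux C2 `ManinOddAtFour` (stmt-BirchSwinnertonDyer-22967), LEAD p1 gen 24;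
`--supports stmt-BirchSwinnertonDyer-22967` (helper).  Assembly (residual L3) of an g51's TURNKEY T-an-g51-52: for every elliptic
`W/ℚ` and every `D : ModularParametrizationData W 52`,

* the coordinates `x` of `D.f` on the `η`-basis `C₁..C₁₀` exist (`…BasisSolveFiftyTwo.exists_coords_fiftyTwo`) and satisfy the
  fourteen column equations `k_n : Σᵢ aₙ(Cᵢ) xᵢ = aₙ(W)` (`coeff_comb52_n`);
* the curve side (`a₂(W) = 0` from `2² ∣ 52` and newness, tree `cuspCoeff_eq_zero_of_sq_dvd_of_mem_newSubspace0`; `2 ∣ N_W`,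
  `3 ∤ N_W` from `IsNewformOf.dvd_level_iff_dvd_conductorNorm`) feeds `LevelFiftyTwo.coeffVector_fiftyTwo`: `x` is `52a`'s
  vector, or one of the two odd parts of `26a`, `26b`;
* the `η`-Fricke law (`EtaFricke.etaQuotient_slash_frickeGL`, `etaFrickeConst_eq_of_sq`) makes `w₅₂` a signed scalar
  permutation of `C₁..C₁₀` (`σ`: `C₃ ↔ C₄`, `C₅ ↔ C₆`, `C₇ ↔ C₈`, `C₉ ↔ C₁₀`; constants `−1, −1, −1/16, −16, −13/16, −16/13,
  −1/4, −4, −1/4, −4`), so `fricke_coords` gives the row `−¼x₇ = εx₈` and `coeffVector_fiftyTwo_of_fricke` kills the odd parts: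

**`f_apply_eq_F52a (D) : ⇑D.f = ⇑F52a`**, `F52a := −C₁ − C₂ + C₇ + ¼C₈ − C₉ − ¼C₁₀ ∈ M₂(Γ₀(52))` (`= 52a1 = [0,0,0,1,−10]`
through `q²⁰⁰`, an g51).  No newness / eigenform / cuspidality statement about `F52a` is
proved; it inherits them from `D.f`.  HONEST FRAMING: unconditional; the Néron squeeze at `52` (x∘φ is a RATIO of weight-2
forms, an g52 T-an-g52-RC) is NOT done here; nothing here proves C2, Manin's conjecture or BSD.
[cite: AtkinLehner1970, Thm. 3] [cite: DiamondShurman2005, §5.8, §8.8] [cite: CremonaAlgorithms1997, Table 3 (N = 52)]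
-/

set_option autoImplicit false
-- lint-debt: the directory name repeats the summit name (sibling precedent `ManinLocalTwoThreeNewformPinningFortyFour.lean`)
set_option linter.dupNamespace false

noncomputable section

open Complex Polynomial
open UpperHalfPlane hiding I
open scoped MatrixGroups ModularForm
open ModularForm CongruenceSubgroup
open Literature.NumberTheory.ModularForms
open Literature.NumberTheory.EllipticCurves Literature.NumberTheory.EllipticCurves.ModularForms

namespace Summit.BirchSwinnertonDyer.BirchSwinnertonDyer.Theorems.ManinLocalTwoThree.LevelFiftyTwo

open EtaFricke

variable {W : WeierstrassCurve ℚ} [W.IsElliptic]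

/-! ## §1 The coordinates of `D.f` and the fourteen column equations -/

omit [W.IsElliptic] in
/-- The coefficients of the modular form underlying `D.f` are the curve's `aₙ`. [folklore] -/
theorem coeff_toModularForm_f52 (D : ModularParametrizationData W 52) (n : ℕ) :
    (qExpansion 1 ⇑(CuspForm.toModularFormₗ D.f)).coeff n = (W.LFunction n : ℂ) := by
  have hcoe : (⇑(CuspForm.toModularFormₗ D.f) : ℍ → ℂ) = ⇑D.f := funext (CuspForm.toModularFormₗ_apply D.f)
  rw [hcoe]
  exact D.isNewformOf.2 n

/-- **Curve side inputs at `52`**: `a₂(W) = 0` (newness, `2² ∣ 52`), `2 ∣ N_W`, `3 ∤ N_W`. [cite: DiamondShurman2005, §5.8, (8.44)] -/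
theorem curveInputs_fiftyTwo (D : ModularParametrizationData W 52) :
    W.LFunction 2 = 0 ∧ 2 ∣ W.conductorNorm ℤ ∧ ¬ 3 ∣ W.conductorNorm ℤ := by
  refine ⟨?_, (D.isNewformOf.dvd_level_iff_dvd_conductorNorm Nat.prime_two).mp ⟨26, by norm_num⟩, fun h3 ↦ ?_⟩
  · have h0 := cuspCoeff_eq_zero_of_sq_dvd_of_mem_newSubspace0 D.isNewformOf.1.1 Nat.prime_two ⟨13, by norm_num⟩
    rw [D.isNewformOf.2 2] at h0
    exact_mod_cast h0
  · have := (D.isNewformOf.dvd_level_iff_dvd_conductorNorm Nat.prime_three).mpr h3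
    omega

/-- Coercion of a ten-form combination to functions. [folklore] -/
theorem coe_sum_smul_basis52 (c : Fin 10 → ℂ) :
    (⇑(∑ i, c i • basis52 i) : ℍ → ℂ) = ∑ i, c i • (⇑(basis52 i) : ℍ → ℂ) := by
  change ModularForm.coeHom (∑ i, c i • basis52 i) = ∑ i, c i • (⇑(basis52 i) : ℍ → ℂ)
  rw [map_sum]
  exact Finset.sum_congr rfl fun i _ ↦ rfl

/-- The ten forms are linearly independent AS FUNCTIONS on `ℍ`. [folklore] -/
theorem linearIndependent_coe_basis52 : LinearIndependent ℂ (fun i ↦ (⇑(basis52 i) : ℍ → ℂ)) := by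
  rw [Fintype.linearIndependent_iff]
  intro g hg
  have h0 : (∑ i, g i • basis52 i : ModularForm (Gamma0 52) 2) = 0 := by
    apply DFunLike.coe_injective
    rw [coe_sum_smul_basis52]
    simpa using hg
  exact Fintype.linearIndependent_iff.mp linearIndependent_basis52 g h0

/-! ## §3 The Fricke matrix and the pinning -/

/-- The matrix of `w₅₂` on `(C₁, …, C₁₀)`: `Cᵢ ∣₂ w₅₂ = Σⱼ Φ j i • Cⱼ` (a signed scalar permutation). [folklore] -/
def Phi52 : Fin 10 → Fin 10 → ℂ :=
  ![![(-(1 : ℂ)), 0, 0, 0, 0, 0, 0, 0, 0, 0],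
    ![0, (-(1 : ℂ)), 0, 0, 0, 0, 0, 0, 0, 0],
    ![0, 0, 0, (-(16 : ℂ)), 0, 0, 0, 0, 0, 0],
    ![0, 0, (-((1 : ℂ) / 16)), 0, 0, 0, 0, 0, 0, 0],
    ![0, 0, 0, 0, 0, (-((16 : ℂ) / 13)), 0, 0, 0, 0],
    ![0, 0, 0, 0, (-((13 : ℂ) / 16)), 0, 0, 0, 0, 0],
    ![0, 0, 0, 0, 0, 0, 0, (-(4 : ℂ)), 0, 0],
    ![0, 0, 0, 0, 0, 0, (-((1 : ℂ) / 4)), 0, 0, 0],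
    ![0, 0, 0, 0, 0, 0, 0, 0, 0, (-(4 : ℂ))],
    ![0, 0, 0, 0, 0, 0, 0, 0, (-((1 : ℂ) / 4)), 0]]

/-- The ten Fricke rows in matrix form. [cite: AtkinLehner1970, Thm. 3] -/
theorem slash_basis52 : ∀ i : Fin 10,
    (⇑(basis52 i) : ℍ → ℂ) ∣[(2 : ℤ)] (glCast (frickeGL 52 : GL (Fin 2) ℚ) : GL (Fin 2) ℝ) = ∑ j, Phi52 j i • (⇑(basis52 j) : ℍ → ℂ) := by
  simp only [Fin.forall_fin_succ, IsEmpty.forall_iff, and_true]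
  refine ⟨?_, ?_, ?_, ?_, ?_, ?_, ?_, ?_, ?_, ?_⟩ <;>
    simp only [basis52, Phi52, Fin.sum_univ_succ, Fin.sum_univ_zero, Matrix.cons_val_zero, Matrix.cons_val_succ,
      zero_smul, add_zero, zero_add]
  exacts [slash_C1, slash_C2, slash_C3, slash_C4, slash_C5, slash_C6, slash_C7, slash_C8, slash_C9, slash_C10]

/-- **The explicit newform** `F₅₂ₐ = −C₁ − C₂ + C₇ + ¼C₈ − C₉ − ¼C₁₀ ∈ M₂(Γ₀(52))`. [cite: CremonaAlgorithms1997, Table 3 (N = 52)] -/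
def F52a : ModularForm (Gamma0 52) 2 :=
  (-1 : ℂ) • C1 + (-1 : ℂ) • C2 + (1 : ℂ) • C7 + ((1 : ℂ) / 4) • C8 + (-1 : ℂ) • C9 + (-(1 : ℂ) / 4) • C10

/-- **THE NEWFORM OF EVERY `X₀(52)`-DATUM IS `F₅₂ₐ`** — FACT-FREE (curve side + Fricke sieve; the sieve also reads the
Fricke sign `ε(D.f) = −1`, kept internal here).
[cite: AtkinLehner1970, Thm. 3] [cite: CremonaAlgorithms1997, Table 3 (N = 52)] -/
theorem f_apply_eq_F52a (D : ModularParametrizationData W 52) : (⇑D.f : ℍ → ℂ) = ⇑F52a := by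
  obtain ⟨ha2, h2N, h3N⟩ := curveInputs_fiftyTwo D
  obtain ⟨x, hx⟩ := exists_coords_fiftyTwo (CuspForm.toModularFormₗ D.f)
  have hcoe : (⇑(CuspForm.toModularFormₗ D.f) : ℍ → ℂ) = ⇑D.f := funext (CuspForm.toModularFormₗ_apply D.f)
  -- the column equations
  have kk : ∀ n : ℕ, (qExpansion 1 ⇑(∑ i, x i • basis52 i)).coeff n = (W.LFunction n : ℂ) := fun n ↦ by
    rw [← hx]; exact coeff_toModularForm_f52 D n
  have k1 := kk 1; rw [coeff_comb52_1] at k1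
  have k2 := kk 2; rw [coeff_comb52_2] at k2
  have k3 := kk 3; rw [coeff_comb52_3] at k3
  have k4 := kk 4; rw [coeff_comb52_4] at k4
  have k5 := kk 5; rw [coeff_comb52_5] at k5
  have k6 := kk 6; rw [coeff_comb52_6] at k6
  have k7 := kk 7; rw [coeff_comb52_7] at k7
  have k8 := kk 8; rw [coeff_comb52_8] at k8
  have k9 := kk 9; rw [coeff_comb52_9] at k9
  have k13 := kk 13; rw [coeff_comb52_13] at k13
  have k15 := kk 15; rw [coeff_comb52_15] at k15
  have k21 := kk 21; rw [coeff_comb52_21] at k21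
  have k26 := kk 26; rw [coeff_comb52_26] at k26
  have k39 := kk 39; rw [coeff_comb52_39] at k39
  have htri := coeffVector_fiftyTwo W ha2 h2N h3N (x 0) (x 1) (x 2) (x 3) (x 4) (x 5) (x 6) (x 7) (x 8) (x 9)
    (by linear_combination k1) (by linear_combination k2) (by linear_combination k3) (by linear_combination k4)
    (by linear_combination k5) (by linear_combination k6) (by linear_combination k7) (by linear_combination k8)
    (by linear_combination k9) (by linear_combination k13) (by linear_combination k15) (by linear_combination k21)
    (by linear_combination k26) (by linear_combination k39)
  -- the Fricke sieve
  have hf : (⇑D.f : ℍ → ℂ) = ∑ i, x i • (⇑(basis52 i) : ℍ → ℂ) := by rw [← hcoe, hx, coe_sum_smul_basis52]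
  obtain ⟨ε, hε, hrows⟩ := fricke_coords D (fun i ↦ (⇑(basis52 i) : ℍ → ℂ)) linearIndependent_coe_basis52 x hf Phi52 slash_basis52
  have hrow := hrows ((0 : Fin 3).succ.succ.succ.succ.succ.succ.succ)
  simp only [Phi52, Fin.sum_univ_succ, Fin.sum_univ_zero, Matrix.cons_val_zero, Matrix.cons_val_succ,
    zero_mul, add_zero, zero_add] at hrow
  simp only [LevelFortyFive.finSucc6, LevelFortyFive.finSucc7] at hrow
  obtain ⟨⟨h0, h1, h2, h3, h4, h5, h6, h7, h8, h9⟩, -⟩ :=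
    coeffVector_fiftyTwo_of_fricke (x 0) (x 1) (x 2) (x 3) (x 4) (x 5) (x 6) (x 7) (x 8) (x 9) htri hε
      (by linear_combination hrow)
  rw [hf, F52a]
  simp only [Fin.sum_univ_succ, Fin.sum_univ_zero, basis52, Matrix.cons_val_zero, Matrix.cons_val_succ,
    LevelFortyFive.finSucc1, LevelFortyFive.finSucc2, LevelFortyFive.finSucc3, LevelFortyFive.finSucc4, LevelFortyFive.finSucc5, LevelFortyFive.finSucc6, LevelFortyFive.finSucc7, LevelFortyFive.finSucc8, LevelFortyFive.finSucc9,
    h0, h1, h2, h3, h4, h5, h6, h7, h8, h9, ModularForm.coe_add]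
  ext τ
  simp only [Pi.add_apply, Pi.smul_apply, Pi.zero_apply,
    ModularForm.IsGLPos.smul_apply, smul_eq_mul]
  ring

end Summit.BirchSwinnertonDyer.BirchSwinnertonDyer.Theorems.ManinLocalTwoThree.LevelFiftyTwo

end
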